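import Summits.QuantumFields.GaugeBoot.TiltedLinkRPHolonomy
import Summits.QuantumFields.GaugeBoot.TiltedBoxOddAxisSlab
import Summits.QuantumFields.GaugeBoot.TwistedSlabHaar
import HarnessLib

/-!
# The slab between the layers `0` and `1` of a site frame, read on the layer above (gauge-boot, L3 negative supplement; SU(3) link reflection at `β < 0`, part 5)

HONEST FRAMING (cell `pub-gaugeboot`, page 1 of every file): the venture produces certified bounds
on lattice expectations at stated coupling, gauge group, dimension and torus size; NOT a mass gap,
NOT a continuum limit, NOT a string tension; NOT Yang–Mills-summit-bearing (barriers
`FixedCouplingUltralocality`, `PerturbativeInvisibility`). Bookkeeping for a NEGATIVE structural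
result (`FrameLinkRPNegativeBeta.lean`).

Setting: a periodic lattice `(A, e)` with a SITE FRAME `IsSiteFrame e k σ Q h` along `k`
(`TiltedSiteRPGeometry.lean`; e.g. every axis of the even cubic torus, `CubicTorusFrames.lean`) and
its mid-plane (link) reflection `x ↦ σ x + e_k` in the hyperplane `h = ½`
(`TiltedLinkRPGeometry.lean`). The crossing plaquettes of the Osterwalder–Seiler splitting
`∑_p Re tr ρ(U_p) = A(U) + A(ΘU) + X(U)` (`IsSiteFrame.sum_plaqObs_split_mid`) are the LOWER ones
(a `k`-side based in the layer `h = 0`, cut by `h = ½`) and the UPPER ones (based in the layer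
`h = Q`, cut by `h = Q + ½`). This file is the uniform "slab" bookkeeping of
`TiltedBoxSquareSlab.lean` (there for the tilted box) for the lower slab of an arbitrary site frame:

* `IsLowerPlaq`, `IsUpperPlaq`, `sum_cross_eq_sum_lower_add_sum_upper` (`Q ≥ 2`);
* `lowerBlock` — the links `(y', n)`, `h y' = 1`, `n ≠ k` (the layer above the slab); the lower
  slab plaquette `(y; k, n)` has holonomy `C₁ B C₂⁻¹ A⁻¹`, `A = U(y, n)` (layer `0`),
  `B = U(y + e_k, n)` (block), `C₁ = U(y, k)`, `C₂ = U(y + e_n, k)` (crossing links), so its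
  Boltzmann factor is `w_β(a_t B⁻¹ b_t)`, `t = (y + e_k, n)`, `a_t = A C₂`, `b_t = C₁⁻¹`
  (`lowerA`, `lowerB`), and **`prod_exp_lower_eq`**:
  `∏_{p lower} exp(β Re tr ρ(U_p)) = ∏_{t ∈ lowerBlock} w_β(a_t(U) U_t⁻¹ b_t(U))` — the shape of
  `TwistedSlab.slab_integral_frozen` / `Baryon.theta_slab_integral_frozen`;
* `lowerA`/`lowerB` are continuous and depend only on links OFF the block; the transferred value
  `b_t a_t = U(y,k)⁻¹ U(y,n) U(y + e_n,k)` is the layer-`0` link variable gauge-transformed by the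
  crossing links (`lowerB_mul_lowerA`);
* `dependsOn_exp_upper` — the upper slab factor depends only on links of height `Q`, `Q + 1`
  (off every link of height `≤ 1` when `Q ≥ 2`), `exp_upper_pos`.

Everything is `[folklore]` bookkeeping.

References: K. Osterwalder, E. Seiler, Ann. Phys. 110 (1978) 440, §2; J. Fröhlich, R. Israel,
E. H. Lieb, B. Simon, J. Stat. Phys. 22 (1980) 297, §3.
-/

noncomputable section

open Literature.RepresentationTheory.CompactGroups

namespace Summit.QuantumFields.GaugeBoot

namespace TiltedRP

variable {A : Type*} [AddCommGroup A] {d : ℕ}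

/-! ## Lower and upper crossing plaquettes, the block above the lower slab -/

section Defs

variable (e : Fin d → A) (k : Fin d) (Q : ℕ) (h : A →+ ZMod (2 * Q))

/-- **A lower slab plaquette**: a `k`-side, based in the layer `h = 0` (cut by `h = ½`). [folklore] -/
def IsLowerPlaq (p : Plaq A d) : Prop := HasDir p k ∧ (h p.1).val = 0

/-- **An upper slab plaquette**: a `k`-side, based in the layer `h = Q` (cut by `h = Q + ½`).
[folklore] -/
def IsUpperPlaq (p : Plaq A d) : Prop := HasDir p k ∧ (h p.1).val = Q

/-- **A block link above the lower slab**: `(y', n)` with `h y' = 1` and `n ≠ k`. [folklore] -/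
def IsLowerBlockLink (t : Link A d) : Prop := (h t.1).val = 1 ∧ t.2 ≠ k

/-- `IsLowerPlaq` is decidable. [folklore] -/
instance instDecidableIsLowerPlaq (p : Plaq A d) : Decidable (IsLowerPlaq k Q h p) := by
  unfold IsLowerPlaq HasDir; infer_instance

/-- `IsUpperPlaq` is decidable. [folklore] -/
instance instDecidableIsUpperPlaq (p : Plaq A d) : Decidable (IsUpperPlaq k Q h p) := by
  unfold IsUpperPlaq HasDir; infer_instance

/-- `IsLowerBlockLink` is decidable. [folklore] -/
instance instDecidableIsLowerBlockLink (t : Link A d) : Decidable (IsLowerBlockLink k Q h t) := by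
  unfold IsLowerBlockLink; infer_instance

/-- **The block**: the finite set of block links above the lower slab. [folklore] -/
def lowerBlock [Fintype A] : Finset (Link A d) := Finset.univ.filter (IsLowerBlockLink k Q h)

variable {G : Type*} [Group G]

/-- The frozen neighbour `a_t = U(y, n) U(y + e_n, k)` of the block link `t = (y + e_k, n)` (and `1`
off the block). [folklore] -/
def lowerA (t : Link A d) (U : Config A d G) : G :=
  if IsLowerBlockLink k Q h t then U (t.1 - e k, t.2) * U (t.1 - e k + e t.2, k) else 1

/-- The frozen neighbour `b_t = U(y, k)⁻¹` of the block link `t = (y + e_k, n)` (and `1` off the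
block). [folklore] -/
def lowerB (t : Link A d) (U : Config A d G) : G :=
  if IsLowerBlockLink k Q h t then (U (t.1 - e k, k))⁻¹ else 1

end Defs

section Basic

variable {e : Fin d → A} {k : Fin d} {Q : ℕ} {h : A →+ ZMod (2 * Q)}

/-- Membership in the block. [folklore] -/
theorem mem_lowerBlock [Fintype A] {t : Link A d} :
    t ∈ lowerBlock k Q h ↔ (h t.1).val = 1 ∧ t.2 ≠ k := by
  simp [lowerBlock, IsLowerBlockLink]

/-- A `k`-link is not in the block. [folklore] -/
theorem not_mem_lowerBlock_of_dir [Fintype A] (x : A) : (x, k) ∉ lowerBlock k Q h :=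
  fun hx => (mem_lowerBlock.1 hx).2 rfl

/-- A link based at height `≠ 1` is not in the block. [folklore] -/
theorem not_mem_lowerBlock_of_height [Fintype A] {x : A} (hx : (h x).val ≠ 1) (n : Fin d) :
    (x, n) ∉ lowerBlock k Q h := fun hx' => hx (mem_lowerBlock.1 hx').1

variable {G : Type*} [Group G]

/-- **The transferred link value `b_t a_t = U(y,k)⁻¹ U(y,n) U(y + e_n,k)`** on the block: the link
variable of the layer `0` below, gauge-transformed by the crossing links. [folklore] -/
theorem lowerB_mul_lowerA {t : Link A d} (ht : IsLowerBlockLink k Q h t) (U : Config A d G) :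
    lowerB e k Q h t U * lowerA e k Q h t U =
      (U (t.1 - e k, k))⁻¹ * U (t.1 - e k, t.2) * U (t.1 - e k + e t.2, k) := by
  simp only [lowerA, lowerB, if_pos ht, mul_assoc]

section Continuity

variable [TopologicalSpace G] [IsTopologicalGroup G]

/-- `a_t` is continuous. [folklore] -/
theorem continuous_lowerA (t : Link A d) : Continuous (lowerA (G := G) e k Q h t) := by
  unfold lowerA
  by_cases ht : IsLowerBlockLink k Q h t
  · simp only [if_pos ht]
    exact (continuous_apply _).mul (continuous_apply _)
  · simp only [if_neg ht]
    exact continuous_const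

/-- `b_t` is continuous. [folklore] -/
theorem continuous_lowerB (t : Link A d) : Continuous (lowerB (G := G) e k Q h t) := by
  unfold lowerB
  by_cases ht : IsLowerBlockLink k Q h t
  · simp only [if_pos ht]
    exact (continuous_apply _).inv
  · simp only [if_neg ht]
    exact continuous_const

end Continuity

end Basic

namespace IsSiteFrame

variable {e : Fin d → A} {k : Fin d} {σ : A →+ A} {Q : ℕ} {h : A →+ ZMod (2 * Q)}
variable (hF : IsSiteFrame e k σ Q h)
include hF

/-! ## Heights around the lower slab -/

/-- Above the layer `0`: `h(y + e_k) = 1` when `h y = 0`. [folklore] -/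
theorem val_height_add_self_of_zero {y : A} (hy : (h y).val = 0) : (h (y + e k)).val = 1 := by
  have hQ := hF.two_le
  rw [hF.val_height_add_self_of_lt (by omega), hy]

/-- Below the layer `1`: `h(y' - e_k) = 0` when `h y' = 1`. [folklore] -/
theorem val_height_sub_self_of_one {y' : A} (hy : (h y').val = 1) : (h (y' - e k)).val = 0 := by
  have h1 := hF.val_height_add_self (y' - e k)
  rw [sub_add_cancel, hy] at h1
  split_ifs at h1; omega

omit hF in
/-- **Crossing = lower or upper**, for the crossing plaquettes of `TiltedLinkRPPlaquettes.lean`.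
[folklore] -/
theorem isMidCrossPlaq_iff (p : Plaq A d) :
    IsMidCrossPlaq k Q h p ↔ IsLowerPlaq k Q h p ∨ IsUpperPlaq k Q h p := by
  unfold IsMidCrossPlaq IsLowerPlaq IsUpperPlaq
  tauto

/-- Lower and upper slab plaquettes are distinct (`Q ≥ 2 > 0`). [folklore] -/
theorem not_isUpperPlaq_of_isLowerPlaq {p : Plaq A d} (hp : IsLowerPlaq k Q h p) :
    ¬ IsUpperPlaq k Q h p := fun hp' => by
  have hQ := hF.two_le
  have h1 := hp.2
  rw [hp'.2] at h1
  omega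

open scoped Classical in
/-- **The crossing sum splits into the lower and the upper slab.** [folklore] -/
theorem sum_cross_eq_sum_lower_add_sum_upper [Fintype A] (f : Plaq A d → ℝ) :
    ∑ p ∈ Finset.univ.filter (IsMidCrossPlaq k Q h), f p =
      ∑ p ∈ Finset.univ.filter (IsLowerPlaq k Q h), f p +
        ∑ p ∈ Finset.univ.filter (IsUpperPlaq k Q h), f p := by
  rw [← Finset.sum_union]
  · refine Finset.sum_congr ?_ fun _ _ => rfl
    ext p
    simp only [Finset.mem_filter, Finset.mem_univ, true_and, Finset.mem_union, isMidCrossPlaq_iff]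
  · rw [Finset.disjoint_filter]
    intro p _ hp
    exact hF.not_isUpperPlaq_of_isLowerPlaq hp

/-! ## The frozen neighbours depend only on links off the block -/

variable {G : Type*} [Group G] [DecidableEq A]

omit [DecidableEq A] in
/-- The base point below a block link lies in the layer `0`. [folklore] -/
theorem val_height_base_of_mem [Fintype A] {t : Link A d} (ht : t ∈ lowerBlock k Q h) :
    (h (t.1 - e k)).val = 0 :=
  hF.val_height_sub_self_of_one (mem_lowerBlock.1 ht).1

/-- `a_t` depends only on links off the block. [folklore] -/
theorem dependsOn_lowerA [Fintype A] (t : Link A d) :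
    DependsOn (lowerA (G := G) e k Q h t) (((lowerBlock k Q h)ᶜ : Finset (Link A d)) : Set (Link A d)) := by
  intro U V hUV
  unfold lowerA
  by_cases ht : IsLowerBlockLink k Q h t
  · have h0 : (h (t.1 - e k)).val = 0 := hF.val_height_sub_self_of_one ht.1
    have h0' : (h (t.1 - e k + e t.2)).val = 0 := by rw [hF.height_add_other _ ht.2, h0]
    rw [if_pos ht, if_pos ht,
      hUV _ (by simpa using not_mem_lowerBlock_of_height (by rw [h0]; omega) t.2),
      hUV _ (by simpa using not_mem_lowerBlock_of_dir (t.1 - e k + e t.2))]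
  · rw [if_neg ht, if_neg ht]

omit hF in
/-- `b_t` depends only on links off the block. [folklore] -/
theorem dependsOn_lowerB [Fintype A] (t : Link A d) :
    DependsOn (lowerB (G := G) e k Q h t) (((lowerBlock k Q h)ᶜ : Finset (Link A d)) : Set (Link A d)) := by
  intro U V hUV
  unfold lowerB
  by_cases ht : IsLowerBlockLink k Q h t
  · rw [if_pos ht, if_pos ht, hUV _ (by simpa using not_mem_lowerBlock_of_dir (t.1 - e k))]
  · rw [if_neg ht, if_neg ht]

/-! ## The lower slab plaquettes are the weights of the block -/

variable {N : ℕ} [TopologicalSpace G] [IsTopologicalGroup G] [CompactSpace G]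
  (ρ : G →* Matrix (Fin N) (Fin N) ℂ)

omit [DecidableEq A] in
/-- The Boltzmann factor of one lower slab plaquette is the weight of the block link above it.
[folklore] -/
theorem exp_plaqObs_lower_eq (hρ : Continuous ρ) (β : ℝ) (U : Config A d G) {p : Plaq A d}
    (hdir : HasDir p k) (hlay : (h p.1).val = 0) :
    Real.exp (β * plaqObs ρ e p U) =
      TwistedSlab.wilsonWeight ρ β
        (lowerA e k Q h (p.1 + e k, otherDir k p) U * (U (p.1 + e k, otherDir k p))⁻¹ *
          lowerB e k Q h (p.1 + e k, otherDir k p) U) := by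
  have ht : IsLowerBlockLink k Q h (p.1 + e k, otherDir k p) :=
    ⟨hF.val_height_add_self_of_zero hlay, otherDir_ne hdir⟩
  rw [plaqObs_of_hasDir ρ hρ hdir, TwistedSlab.wilsonWeight, ← CompactGroup.re_trace_map_inv ρ hρ]
  have hX : (holonomy e U p.1 k (otherDir k p))⁻¹ =
      lowerA e k Q h (p.1 + e k, otherDir k p) U * (U (p.1 + e k, otherDir k p))⁻¹ *
        lowerB e k Q h (p.1 + e k, otherDir k p) U := by
    simp only [lowerA, lowerB, if_pos ht, holonomy, add_sub_cancel_right]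
    group
  rw [hX]

omit [DecidableEq A] in
open scoped Classical in
/-- **The Boltzmann factor of the lower slab, read on the block**:
`∏_{p lower} exp(β Re tr ρ(U_p)) = ∏_{t ∈ lowerBlock} w_β(a_t(U) U_t⁻¹ b_t(U))`. [folklore] -/
theorem prod_exp_lower_eq [Fintype A] (hρ : Continuous ρ) (β : ℝ) (U : Config A d G) :
    ∏ p ∈ Finset.univ.filter (IsLowerPlaq k Q h), Real.exp (β * plaqObs ρ e p U) =
      ∏ t ∈ lowerBlock k Q h,
        TwistedSlab.wilsonWeight ρ β (lowerA e k Q h t U * (U t)⁻¹ * lowerB e k Q h t U) := by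
  refine Finset.prod_bij'
    (fun p _ => (p.1 + e k, otherDir k p))
    (fun t ht => (t.1 - e k, mkDirPair k t.2 (mem_lowerBlock.1 ht).2))
    (fun p hp => ?_) (fun t ht => ?_) (fun p hp => ?_) (fun t ht => ?_) (fun p hp => ?_)
  · -- into the block
    rw [Finset.mem_filter] at hp
    obtain ⟨-, hdir, hlay⟩ := hp
    exact mem_lowerBlock.2 ⟨hF.val_height_add_self_of_zero hlay, otherDir_ne hdir⟩
  · -- back to the slab
    rw [Finset.mem_filter]
    exact ⟨Finset.mem_univ _, mkDirPair_hasDir k t.2 (mem_lowerBlock.1 ht).2,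
      hF.val_height_base_of_mem ht⟩
  · -- left inverse
    rw [Finset.mem_filter] at hp
    obtain ⟨-, hdir, -⟩ := hp
    ext1
    · exact add_sub_cancel_right _ _
    · exact mkDirPair_otherDir p hdir
  · -- right inverse
    ext1
    · exact sub_add_cancel _ _
    · exact otherDir_mkDirPair _ k t.2 (mem_lowerBlock.1 ht).2
  · -- the value
    rw [Finset.mem_filter] at hp
    obtain ⟨-, hdir, hlay⟩ := hp
    exact hF.exp_plaqObs_lower_eq ρ hρ β U hdir hlay

omit [CompactSpace G] [DecidableEq A] hF in
/-- Continuity of the block weight product (as a complex-valued function). [folklore] -/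
theorem continuous_lowerProd [Fintype A] (hρ : Continuous ρ) (β : ℝ) :
    Continuous fun U : Config A d G =>
      ∏ t ∈ lowerBlock k Q h,
        (TwistedSlab.wilsonWeight ρ β (lowerA e k Q h t U * (U t)⁻¹ * lowerB e k Q h t U) : ℂ) :=
  continuous_finsetProd _ fun t _ => Complex.continuous_ofReal.comp
    ((TwistedSlab.continuous_wilsonWeight ρ hρ β).comp
      (((continuous_lowerA t).mul (continuous_apply t).inv).mul (continuous_lowerB t)))

/-! ## The upper slab factor -/

omit [DecidableEq A] in
/-- **The upper slab factor depends only on links of height `Q` or `Q + 1`**: in particular it is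
independent of every link based at height `0` or `1` (`Q ≥ 2`). Stated as dependence on the
links based at heights other than `0` and `1`. [folklore] -/
theorem dependsOn_exp_upper [Fintype A] (hρ : Continuous ρ) (β : ℝ) :
    DependsOn (fun U : Config A d G =>
        ∏ p ∈ Finset.univ.filter (IsUpperPlaq k Q h), Real.exp (β * plaqObs ρ e p U))
      {t : Link A d | (h t.1).val ≠ 0 ∧ (h t.1).val ≠ 1} := by
  classical
  intro U V hUV
  refine Finset.prod_congr rfl fun p hp => ?_
  rw [Finset.mem_filter] at hp
  obtain ⟨-, hdir, hlay⟩ := hp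
  have hQ := hF.two_le
  have hm := otherDir_ne (k := k) hdir
  -- the four links of `(p.1; k, m)`: heights `Q`, `Q`, `Q + 1`, `Q`
  have h1 : (h p.1).val ≠ 0 ∧ (h p.1).val ≠ 1 := by rw [hlay]; omega
  have h2 : (h (p.1 + e k)).val ≠ 0 ∧ (h (p.1 + e k)).val ≠ 1 := by
    rw [hF.val_height_add_self_of_lt (by rw [hlay]; omega), hlay]; omega
  have h3 : (h (p.1 + e (otherDir k p))).val ≠ 0 ∧ (h (p.1 + e (otherDir k p))).val ≠ 1 := by
    rw [hF.height_add_other _ hm, hlay]; omega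
  rw [plaqObs_of_hasDir ρ hρ hdir U, plaqObs_of_hasDir ρ hρ hdir V]
  unfold holonomy
  rw [hUV _ h1, hUV _ h2, hUV _ h3, hUV _ h1]

omit [TopologicalSpace G] [IsTopologicalGroup G] [CompactSpace G] [DecidableEq A] hF in
/-- The upper slab factor is positive. [folklore] -/
theorem exp_upper_pos [Fintype A] (β : ℝ) (U : Config A d G) :
    0 < ∏ p ∈ Finset.univ.filter (IsUpperPlaq k Q h), Real.exp (β * plaqObs ρ e p U) :=
  Finset.prod_pos fun _ _ => Real.exp_pos _

omit [CompactSpace G] [DecidableEq A] hF in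
/-- The upper slab factor is continuous. [folklore] -/
theorem continuous_exp_upper [Fintype A] (hρ : Continuous ρ) (β : ℝ) :
    Continuous fun U : Config A d G =>
      ∏ p ∈ Finset.univ.filter (IsUpperPlaq k Q h), Real.exp (β * plaqObs ρ e p U) :=
  continuous_finsetProd _ fun p _ => Real.continuous_exp.comp
    (continuous_const.mul (continuous_plaqObs ρ hρ e p))

end IsSiteFrame

end TiltedRP

end Summit.QuantumFields.GaugeBoot

end
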